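import Summits.Ventures.PercRepro.C041TriDomTwoCutInduction

/-!
# ROW C-041 — THE STOCKED HOST: A PLAIN HOST IS A STOCKED STATUS OF ITS HOST WITH THE CHORDS ADDED
(p6, gen 46; P6-TWOEXIT-LEAN.md §53 ADDENDUM 18)

The STOCKED HOST of a host `Z₁` (`stockedHost`): the same vertices, the edges of `Z₁` (`Sum.inl`) plus, for every
ordered pair of vertices `(u, v)` and every `k < #E`, a chord edge `Sum.inr (u, v, k)` joining `u` and `v`.  A status
`st` of `Z₁` becomes the status `liftSt st` of the stocked host with every chord ABSENT; absent edges are invisible to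
the connectivities (`RdS_lift`, `MgS_lift`), so the classes agree (`cycCrossedS_lift`, `topBotS_lift`) and the
up-set counts of the stocked host are `2^{#chords}` times those of the host (`card_lift`): CONJECTURE (STOCHASTIC
DOMINATION) on the lifted status gives it on `st` (`cycDominationS_of_lift`).  The lifted status is stocked
(`stocked_liftSt`: every pair has `#E ≥ npres st` absent chords).  **THEOREM (REDUCTION, 2-CUT FORM, PLAIN HOSTS)**
(`cycDomination_of_stockedCore_host`): CONJECTURE (STOCHASTIC DOMINATION) on a finite host follows from the conjecture
and the sibling on the stocked statuses of its stocked host that have no cut, no two-exit piece, no redundant edge,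
no parallel pair and no markless 2-cut far side — «3-connected modulo the marks».
-/

namespace PercRepro

namespace ZoneZ

namespace MultiExit

open ZoneData Finset Classical

variable {V₁ E₁ U₁ U₂ : Type} (Z₁ : ZoneData V₁ E₁ U₁ U₂)

/-! ## The stocked host and the lifted status -/

variable (E₀ : Type) (ends : E₀ → V₁ × V₁)

/-- The host `Z₁` with the extra edges `E₀` (endpoints `ends`) added. -/
def addEdges : ZoneData V₁ (E₁ ⊕ E₀) U₁ U₂ where
  fst := fun e => Sum.elim Z₁.fst (fun k => (ends k).1) e
  snd := fun e => Sum.elim Z₁.snd (fun k => (ends k).2) e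
  at₁ := Z₁.at₁
  at₂ := Z₁.at₂

/-- A status of `Z₁` lifted to the host with extra edges: the extra edges are absent. -/
def liftSt (st : E₁ → EStat) : E₁ ⊕ E₀ → EStat := Sum.elim st fun _ => EStat.absent

/-- A colouring of the host with extra edges restricted to `Z₁`. -/
def restr (ω : E₁ ⊕ E₀ → Bool) : E₁ → Bool := fun e => ω (Sum.inl e)

variable {E₀ ends}

/-- An edge of `Z₁` joins in the extended host what it joins in `Z₁`. -/
theorem joins_inl (e : E₁) (x y : V₁) : (addEdges Z₁ E₀ ends).Joins (Sum.inl e) x y ↔ Z₁.Joins e x y := Iff.rfl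

/-- An extra edge joins its ends. -/
theorem joins_inr (k : E₀) (x y : V₁) :
    (addEdges Z₁ E₀ ends).Joins (Sum.inr k) x y ↔ ((ends k).1 = x ∧ (ends k).2 = y) ∨ ((ends k).1 = y ∧ (ends k).2 = x) :=
  Iff.rfl

/-- The red adjacency of the lifted status is that of `st` on the restricted colouring. -/
theorem RAdjS_lift (st : E₁ → EStat) (ω : E₁ ⊕ E₀ → Bool) :
    RAdjS (addEdges Z₁ E₀ ends) (liftSt E₀ st) ω = RAdjS Z₁ st (restr E₀ ω) := by
  funext x y
  apply propext
  constructor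
  · rintro ⟨e, hj, he⟩
    rcases e with e | k
    · exact ⟨e, hj, he⟩
    · exact absurd he (by unfold redE liftSt; simp)
  · rintro ⟨e, hj, he⟩
    exact ⟨Sum.inl e, hj, he⟩

/-- The blue adjacency of the lifted status is that of `st` on the restricted colouring. -/
theorem BAdjS_lift (st : E₁ → EStat) (ω : E₁ ⊕ E₀ → Bool) :
    BAdjS (addEdges Z₁ E₀ ends) (liftSt E₀ st) ω = BAdjS Z₁ st (restr E₀ ω) := by
  funext x y
  apply propext
  constructor
  · rintro ⟨e, hj, he⟩
    rcases e with e | k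
    · exact ⟨e, hj, he⟩
    · exact absurd he (by unfold blueE liftSt; simp)
  · rintro ⟨e, hj, he⟩
    exact ⟨Sum.inl e, hj, he⟩

/-- The red connectivity of the lifted status. -/
theorem RdS_lift (st : E₁ → EStat) (ω : E₁ ⊕ E₀ → Bool) :
    RdS (addEdges Z₁ E₀ ends) (liftSt E₀ st) ω = RdS Z₁ st (restr E₀ ω) := by
  unfold RdS
  rw [RAdjS_lift]

/-- The blue connectivity of the lifted status. -/
theorem MgS_lift (st : E₁ → EStat) (ω : E₁ ⊕ E₀ → Bool) :
    MgS (addEdges Z₁ E₀ ends) (liftSt E₀ st) ω = MgS Z₁ st (restr E₀ ω) := by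
  unfold MgS
  rw [BAdjS_lift]

/-- The crossed classes of the lifted status. -/
theorem cycCrossedS_lift (st : E₁ → EStat) (x y z : V₁) (ω : E₁ ⊕ E₀ → Bool) :
    CycCrossedS (addEdges Z₁ E₀ ends) x y z (liftSt E₀ st) ω ↔ CycCrossedS Z₁ x y z st (restr E₀ ω) := by
  rw [cycCrossedS_iff, cycCrossedS_iff, RdS_lift, MgS_lift]

/-- The class `(⊤, ⊥)` of the lifted status. -/
theorem topBotS_lift (st : E₁ → EStat) (x y z : V₁) (ω : E₁ ⊕ E₀ → Bool) :
    TopBotS (addEdges Z₁ E₀ ends) x y z (liftSt E₀ st) ω ↔ TopBotS Z₁ x y z st (restr E₀ ω) := by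
  rw [topBotS_iff, topBotS_iff, RdS_lift, MgS_lift]

/-! ## The counts -/

section Count

variable [Fintype E₁] [DecidableEq E₁] [Fintype E₀] [DecidableEq E₀]

variable (E₀) in
/-- The extension of a colouring of `Z₁` by blue extra edges. -/
def ext (ω : E₁ → Bool) : E₁ ⊕ E₀ → Bool := Sum.elim ω fun _ => false

variable (E₀) in
/-- The extra edges, as an edge predicate of the extended host. -/
def IsExtra : E₁ ⊕ E₀ → Prop := fun e => e.isRight = true

omit [Fintype E₁] [DecidableEq E₁] [Fintype E₀] [DecidableEq E₀] in
/-- Restricting the extension gives the colouring back. -/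
theorem restr_ext (ω : E₁ → Bool) : restr E₀ (ext E₀ ω) = ω := rfl

omit [Fintype E₁] [DecidableEq E₁] [Fintype E₀] [DecidableEq E₀] in
/-- The restriction of a colouring depends only on its outside part. -/
theorem restr_outN (ω : E₁ ⊕ E₀ → Bool) : restr E₀ (outN (IsExtra (E₁ := E₁) E₀) ω) = restr E₀ ω := by
  funext e
  unfold restr outN
  rw [merge_of_not_in]
  simp [IsExtra]

/-- The outside parts of the extended host are the extensions. -/
theorem OutSupp_extra : OutSupp (IsExtra (E₁ := E₁) E₀) = Finset.image (ext E₀) Finset.univ := by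
  ext o
  rw [Finset.mem_image]
  constructor
  · intro ho
    refine ⟨restr E₀ o, Finset.mem_univ _, ?_⟩
    funext e
    unfold OutSupp at ho
    rw [Finset.mem_filter] at ho
    rcases e with e | k
    · rfl
    · exact (ho.2 (Sum.inr k) rfl).symm
  · rintro ⟨ω, _, rfl⟩
    unfold OutSupp
    rw [Finset.mem_filter]
    refine ⟨Finset.mem_univ _, fun e he => ?_⟩
    rcases e with e | k
    · exact absurd he (by simp [IsExtra])
    · rfl

omit [Fintype E₁] [DecidableEq E₁] [Fintype E₀] [DecidableEq E₀] in
/-- The extension is injective. -/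
theorem ext_injective : Function.Injective (ext (E₁ := E₁) E₀) := by
  intro ω ω' h
  funext e
  exact congrFun h (Sum.inl e)

/-- A count of an outside-only predicate over the extended host is `#InSupp` times the count over `Z₁`. -/
theorem card_lift (P : (E₁ → Bool) → Prop) :
    (univ.filter fun ω : E₁ ⊕ E₀ → Bool => P (restr E₀ ω)).card =
      (InSupp (IsExtra (E₁ := E₁) E₀)).card * (univ.filter fun ω : E₁ → Bool => P ω).card := by
  rw [card_filter_inst.trans (card_filter_outOnly (IsExtra (E₁ := E₁) E₀) _ fun ω => by rw [restr_outN])]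
  congr 1
  rw [OutSupp_extra, Finset.filter_image, Finset.card_image_of_injective _ (ext_injective (E₁ := E₁) (E₀ := E₀))]
  exact card_filter_congr' fun ω _ => by rw [restr_ext]

/-- CONJECTURE (STOCHASTIC DOMINATION) on the lifted status gives it on `st`. -/
theorem cycDominationS_of_lift (st : E₁ → EStat) (x y z : V₁)
    (h : CycDominationS (addEdges Z₁ E₀ ends) x y z (liftSt E₀ st)) : CycDominationS Z₁ x y z st := by
  intro V hV
  have hV' : UpSet fun ω : E₁ ⊕ E₀ → Bool => V (restr E₀ ω) := by
    intro ω ω' hω hle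
    exact hV _ _ hω fun e he => hle (Sum.inl e) he
  have key := h _ hV'
  have hL : (univ.filter fun ω : E₁ ⊕ E₀ → Bool => V (restr E₀ ω) ∧ CycCrossedS Z₁ x y z st (restr E₀ ω)).card =
      (InSupp (IsExtra (E₁ := E₁) E₀)).card * (univ.filter fun ω : E₁ → Bool => V ω ∧ CycCrossedS Z₁ x y z st ω).card :=
    card_filter_inst.trans ((card_lift (E₀ := E₀) fun ω => V ω ∧ CycCrossedS Z₁ x y z st ω).trans
      (congrArg (fun n => (InSupp (IsExtra (E₁ := E₁) E₀)).card * n) card_filter_inst))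
  have hR : (univ.filter fun ω : E₁ ⊕ E₀ → Bool => V (restr E₀ ω) ∧ TopBotS Z₁ x y z st (restr E₀ ω)).card =
      (InSupp (IsExtra (E₁ := E₁) E₀)).card * (univ.filter fun ω : E₁ → Bool => V ω ∧ TopBotS Z₁ x y z st ω).card :=
    card_filter_inst.trans ((card_lift (E₀ := E₀) fun ω => V ω ∧ TopBotS Z₁ x y z st ω).trans
      (congrArg (fun n => (InSupp (IsExtra (E₁ := E₁) E₀)).card * n) card_filter_inst))
  have key' : (univ.filter fun ω : E₁ ⊕ E₀ → Bool => V (restr E₀ ω) ∧ CycCrossedS Z₁ x y z st (restr E₀ ω)).card ≤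
      (univ.filter fun ω : E₁ ⊕ E₀ → Bool => V (restr E₀ ω) ∧ TopBotS Z₁ x y z st (restr E₀ ω)).card :=
    (card_filter_congr' fun ω _ => and_congr_right fun _ => (cycCrossedS_lift Z₁ st x y z ω).symm).trans_le
      (key.trans_eq (card_filter_congr' fun ω _ => and_congr_right fun _ => topBotS_lift Z₁ st x y z ω))
  rw [hL, hR] at key'
  exact Nat.le_of_mul_le_mul_left key' (card_InSupp_pos _)

end Count

/-! ## The stocked host -/

section Stocked

variable [Fintype E₁] [DecidableEq E₁] [Fintype V₁] [DecidableEq V₁]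

/-- The chords of the stocked host: `#E` parallel edges for every ordered pair of vertices. -/
abbrev Chords : Type := V₁ × V₁ × Fin (Fintype.card E₁)

/-- The ends of a chord. -/
def chordEnds : Chords (V₁ := V₁) (E₁ := E₁) → V₁ × V₁ := fun k => (k.1, k.2.1)

/-- The stocked host of `Z₁`. -/
def stockedHost : ZoneData V₁ (E₁ ⊕ Chords (V₁ := V₁) (E₁ := E₁)) U₁ U₂ :=
  addEdges Z₁ (Chords (V₁ := V₁) (E₁ := E₁)) chordEnds

/-- The lifted status has at most `#E` present edges. -/
theorem npres_liftSt_le (st : E₁ → EStat) :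
    npres (liftSt (Chords (V₁ := V₁) (E₁ := E₁)) st) ≤ Fintype.card E₁ := by
  unfold npres
  have hsub : (univ.filter fun e : E₁ ⊕ Chords (V₁ := V₁) (E₁ := E₁) => presE (liftSt _ st) e) ⊆
      Finset.image Sum.inl Finset.univ := by
    intro e he
    rw [Finset.mem_filter] at he
    rw [Finset.mem_image]
    rcases e with e | k
    · exact ⟨e, Finset.mem_univ _, rfl⟩
    · exact absurd rfl he.2
  exact (Finset.card_le_card hsub).trans (Finset.card_image_le.trans (le_of_eq Finset.card_univ))

/-- Every pair of distinct vertices has `#E` absent chords. -/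
theorem stock_liftSt (st : E₁ → EStat) (u v : V₁) :
    Fintype.card E₁ ≤ stock (stockedHost Z₁) (liftSt (Chords (V₁ := V₁) (E₁ := E₁)) st) u v := by
  unfold stock
  have hsub : Finset.image (fun k : Fin (Fintype.card E₁) => (Sum.inr (u, v, k) : E₁ ⊕ Chords (V₁ := V₁) (E₁ := E₁)))
      Finset.univ ⊆ univ.filter fun e => liftSt _ st e = EStat.absent ∧ (stockedHost Z₁).Joins e u v := by
    intro e he
    rw [Finset.mem_image] at he
    obtain ⟨k, _, rfl⟩ := he
    rw [Finset.mem_filter]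
    exact ⟨Finset.mem_univ _, rfl, Or.inl ⟨rfl, rfl⟩⟩
  refine le_trans ?_ (Finset.card_le_card hsub)
  rw [Finset.card_image_of_injective _ (fun k k' h => by simpa using h), Finset.card_univ, Fintype.card_fin]

/-- The lifted status is stocked. -/
theorem stocked_liftSt (st : E₁ → EStat) : Stocked (stockedHost Z₁) (liftSt (Chords (V₁ := V₁) (E₁ := E₁)) st) :=
  fun u v _ => (npres_liftSt_le st).trans (stock_liftSt Z₁ st u v)

/-- **THEOREM (REDUCTION, 2-CUT FORM, PLAIN HOSTS)**: CONJECTURE (STOCHASTIC DOMINATION) on a finite host follows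
from the conjecture and the sibling on the stocked statuses of its stocked host that have no cut, no two-exit piece,
no redundant edge, no parallel pair and no markless 2-cut far side. -/
theorem cycDomination_of_stockedCore_host
    (hbase : ∀ st : E₁ ⊕ Chords (V₁ := V₁) (E₁ := E₁) → EStat, Stocked (stockedHost Z₁) st → ∀ a b c : V₁,
      ¬ HasCut (stockedHost Z₁) st a b c → ¬ HasTwoExit (stockedHost Z₁) st a b c →
      ¬ HasRedundant (stockedHost Z₁) st → ¬ HasParallel (stockedHost Z₁) st →
      ¬ HasTwoCut (stockedHost Z₁) st a b c →
      CycDominationS (stockedHost Z₁) a b c st ∧ SibDominationS (stockedHost Z₁) a b c st)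
    (x y z : V₁) : CycDomination Z₁ x y z :=
  cycDominationS_of_lift Z₁ (fun _ => EStat.free) x y z
    (cycDominationS_of_stockedCore (stockedHost Z₁) hbase (stocked_liftSt Z₁ _) x y z)

end Stocked

end MultiExit

end ZoneZ

end PercRepro
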